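import Summits.AtomisticToContinuum.Crystallization.Theorems.HullExactificationCascadeZeroDefectDensityCensusCertFan
import Literature.Geometry.DiscreteGeometry.SphericalCapVolume
import HarnessLib

/-!
# Trihedral cones, measure glue and the two model regions for `stub_censusCert`
# (route `HullExactificationCascade`, crux `ZeroDefectDensity`, stmt-AtomisticToContinuum-12086)

Sequel of `…CensusCertFan.lean` (lead c5, worker K2a).  Region-independent glue for the two fan
certificates of `stub_censusCert` (no definitions: the trihedral cone
`T(a,b,c) = {det[b;c;·] ≥ 0} ∩ {det[c;a;·] ≥ 0} ∩ {det[a;b;·] ≥ 0}`, the set of the tree's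
`ballFraction_orient3_inter₃`, is always written out):

* `ballFraction_tri` (`= sphExcess a b c / 4π`), the cone representation `exists_combo_of_mem_tri`
  and the sign of a facet functional on the cone (`orient3_nonpos_of_mem_tri`);
* `ballFraction_le_sum_of_subset` (subadditivity over a finite cover), `ballFraction_mono_null`
  (monotonicity up to a null set), `exists_sign_change` (discrete intermediate values);
* the axis `e_z = EuclideanSpace.single 2 1`, the three rational unit proxies of the statement and
  their inner products in coordinates, membership in `capCone e_z c` in coordinates;
* `dualCone_nonneg`: an integer normal `n` with `n_z > 0`, `(1250² − 893²)(n_x² + n_y²) ≤ 893² n_z²`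
  is nonnegative on the open cone `{(893/1250)‖x‖ < x_z}` (the dual-cone test certifying that a
  facet plane of the circumscribed fan does not cut the cap);
* `combo_mem_cone`: the open cone `{(893/1250)‖x‖ < x_z, x_z < ⟪c₁,x⟫, x_z < ⟪c₂,x⟫}` is closed
  under nonnegative combinations with a positive coefficient (containment of inscribed cones).
-/

noncomputable section

namespace Summit.AtomisticToContinuum.Crystallization.Theorems.ZeroDefectDensityBirth

open Real RealInnerProductSpace InnerProductGeometry MeasureTheory Metric Set
open Literature.Geometry.DiscreteGeometry

/-! ### Trihedral cones in determinant form -/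

section Tri

/-- **Girard–Euler**: the ball fraction of a positively oriented trihedral cone is its excess over
`4π`. -/
theorem ballFraction_tri {a b c : EuclideanSpace ℝ (Fin 3)} (h : 0 < orient3 a b c) :
    ballFraction (0 : EuclideanSpace ℝ (Fin 3)) ({x : EuclideanSpace ℝ (Fin 3) | 0 ≤ orient3 b c x} ∩ {x | 0 ≤ orient3 c a x} ∩ {x | 0 ≤ orient3 a b x}) =
      sphExcess a b c / (4 * π) := by
  rw [ballFraction_orient3_inter₃ h, sphExcess]

/-- A point of a positively oriented trihedral cone is a nonnegative combination of `a, b, c`. -/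
theorem exists_combo_of_mem_tri {a b c x : EuclideanSpace ℝ (Fin 3)} (h : 0 < orient3 a b c)
    (hx : x ∈ ({x : EuclideanSpace ℝ (Fin 3) | 0 ≤ orient3 b c x} ∩ {x | 0 ≤ orient3 c a x} ∩ {x | 0 ≤ orient3 a b x})) :
    ∃ c₀ c₁ c₂ : ℝ, 0 ≤ c₀ ∧ 0 ≤ c₁ ∧ 0 ≤ c₂ ∧ x = c₀ • a + c₁ • b + c₂ • c := by
  have hx' : x ∈ apexCone (0 : EuclideanSpace ℝ (Fin 3)) ![a, b, c] := by
    rw [← setOf_orient3_inter₃_eq_apexCone h]; exact hx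
  obtain ⟨w, hw, hxw⟩ := hx'
  refine ⟨w 0, w 1, w 2, hw 0, hw 1, hw 2, ?_⟩
  rw [hxw]
  simp [Fin.sum_univ_three]

/-- A functional `det[p; q; ·]` that is `≤ 0` on the three generators is `≤ 0` on the cone. -/
theorem orient3_nonpos_of_mem_tri {a b c x p q : EuclideanSpace ℝ (Fin 3)} (h : 0 < orient3 a b c)
    (hx : x ∈ ({x : EuclideanSpace ℝ (Fin 3) | 0 ≤ orient3 b c x} ∩ {x | 0 ≤ orient3 c a x} ∩ {x | 0 ≤ orient3 a b x}))
    (ha : orient3 p q a ≤ 0) (hb : orient3 p q b ≤ 0) (hc : orient3 p q c ≤ 0) :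
    orient3 p q x ≤ 0 := by
  obtain ⟨c₀, c₁, c₂, h₀, h₁, h₂, rfl⟩ := exists_combo_of_mem_tri h hx
  simp only [orient3_add_right, orient3_smul_right]
  nlinarith [mul_nonpos_of_nonneg_of_nonpos h₀ ha, mul_nonpos_of_nonneg_of_nonpos h₁ hb,
    mul_nonpos_of_nonneg_of_nonpos h₂ hc]

/-- **Subadditivity of ball fractions over a finite cover.** -/
theorem ballFraction_le_sum_of_subset {ι : Type*} (s : Finset ι) {S : Set (EuclideanSpace ℝ (Fin 3))}
    {T : ι → Set (EuclideanSpace ℝ (Fin 3))} (hcover : S ⊆ ⋃ i ∈ s, T i) :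
    ballFraction (0 : EuclideanSpace ℝ (Fin 3)) S ≤ ∑ i ∈ s, ballFraction (0 : EuclideanSpace ℝ (Fin 3)) (T i) := by
  unfold ballFraction
  rw [← Finset.sum_div]
  refine div_le_div_of_nonneg_right ?_ ENNReal.toReal_nonneg
  have htop : volume (ball (0 : EuclideanSpace ℝ (Fin 3)) 1) ≠ ⊤ := measure_ball_lt_top.ne
  have hfin : ∀ i ∈ s, volume (ball (0 : EuclideanSpace ℝ (Fin 3)) 1 ∩ T i) ≠ ⊤ := fun i _ =>
    (measure_lt_top_of_subset inter_subset_left htop).ne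
  have h1 : ball (0 : EuclideanSpace ℝ (Fin 3)) 1 ∩ S ⊆ ⋃ i ∈ s, (ball (0 : EuclideanSpace ℝ (Fin 3)) 1 ∩ T i) := by
    intro x hx
    obtain ⟨i, hi, hxi⟩ := mem_iUnion₂.1 (hcover hx.2)
    exact mem_iUnion₂.2 ⟨i, hi, hx.1, hxi⟩
  calc (volume (ball (0 : EuclideanSpace ℝ (Fin 3)) 1 ∩ S)).toReal
      ≤ (∑ i ∈ s, volume (ball (0 : EuclideanSpace ℝ (Fin 3)) 1 ∩ T i)).toReal :=
        ENNReal.toReal_mono (ENNReal.sum_ne_top.2 hfin)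
          ((measure_mono h1).trans (measure_biUnion_finset_le s _))
    _ = ∑ i ∈ s, (volume (ball (0 : EuclideanSpace ℝ (Fin 3)) 1 ∩ T i)).toReal := ENNReal.toReal_sum hfin

/-- **Monotonicity of ball fractions up to a null set.** -/
theorem ballFraction_mono_null {S T Z : Set (EuclideanSpace ℝ (Fin 3))} (h : ball (0 : EuclideanSpace ℝ (Fin 3)) 1 ∩ S ⊆ T ∪ Z)
    (hZ : volume Z = 0) : ballFraction (0 : EuclideanSpace ℝ (Fin 3)) S ≤ ballFraction (0 : EuclideanSpace ℝ (Fin 3)) T := by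
  unfold ballFraction
  refine div_le_div_of_nonneg_right ?_ ENNReal.toReal_nonneg
  have htop : volume (ball (0 : EuclideanSpace ℝ (Fin 3)) 1) ≠ ⊤ := measure_ball_lt_top.ne
  refine ENNReal.toReal_mono (measure_lt_top_of_subset inter_subset_left htop).ne ?_
  have h2 : ball (0 : EuclideanSpace ℝ (Fin 3)) 1 ∩ S ⊆ (ball (0 : EuclideanSpace ℝ (Fin 3)) 1 ∩ T) ∪ Z := fun x hx => by
    rcases h hx with hT | hZ'
    · exact Or.inl ⟨hx.1, hT⟩
    · exact Or.inr hZ'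
  calc volume (ball (0 : EuclideanSpace ℝ (Fin 3)) 1 ∩ S) ≤ volume ((ball (0 : EuclideanSpace ℝ (Fin 3)) 1 ∩ T) ∪ Z) := measure_mono h2
    _ ≤ volume (ball (0 : EuclideanSpace ℝ (Fin 3)) 1 ∩ T) + volume Z := measure_union_le _ _
    _ = volume (ball (0 : EuclideanSpace ℝ (Fin 3)) 1 ∩ T) := by rw [hZ, add_zero]

/-- **Discrete intermediate value lemma**: a real sequence that is `≥ 0` at `a` and `≤ 0` at
`b > a` changes sign at some step `k ∈ [a, b)`. -/
theorem exists_sign_change (s : ℕ → ℝ) {a : ℕ} (ha : 0 ≤ s a) :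
    ∀ {b : ℕ}, a < b → s b ≤ 0 → ∃ k, a ≤ k ∧ k < b ∧ 0 ≤ s k ∧ s (k + 1) ≤ 0 := by
  intro b
  induction b with
  | zero => intro h; exact absurd h (Nat.not_lt_zero a)
  | succ n ih =>
    intro hab hb
    by_cases hn : s n ≤ 0
    · rcases Nat.lt_or_ge a n with han | han
      · obtain ⟨k, hk1, hk2, hk3, hk4⟩ := ih han hn
        exact ⟨k, hk1, Nat.lt_succ_of_lt hk2, hk3, hk4⟩
      · obtain rfl : a = n := by omega
        exact ⟨a, le_rfl, Nat.lt_succ_self a, ha, hb⟩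
    · exact ⟨n, by omega, Nat.lt_succ_self n, le_of_lt (lt_of_not_ge hn), hb⟩

end Tri

/-! ### The axis, the proxies, the cap cone in coordinates -/

section Region

/-- `⟪e_z, x⟫ = x₂`. -/
theorem inner_ez (x : EuclideanSpace ℝ (Fin 3)) : ⟪(EuclideanSpace.single (2 : Fin 3) (1 : ℝ) : EuclideanSpace ℝ (Fin 3)), x⟫ = x 2 := by
  rw [EuclideanSpace.inner_single_left]; simp

/-- `⟪c_s, x⟫` in coordinates. -/
theorem inner_cS (x : EuclideanSpace ℝ (Fin 3)) :
    ⟪(WithLp.toLp 2 ![(526205 / 607813 : ℝ), 0, 304212 / 607813] : EuclideanSpace ℝ (Fin 3)), x⟫ = 526205 / 607813 * x 0 + 304212 / 607813 * x 2 := by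
  simp [PiLp.inner_apply, Fin.sum_univ_three]; ring

/-- `⟪c₁, x⟫` in coordinates. -/
theorem inner_cA (x : EuclideanSpace ℝ (Fin 3)) :
    ⟪(WithLp.toLp 2 ![(215683 / 248965 : ℝ), 0, 124356 / 248965] : EuclideanSpace ℝ (Fin 3)), x⟫ = 215683 / 248965 * x 0 + 124356 / 248965 * x 2 := by
  simp [PiLp.inner_apply, Fin.sum_univ_three]; ring

/-- `⟪c₂, x⟫` in coordinates. -/
theorem inner_cB (x : EuclideanSpace ℝ (Fin 3)) :
    ⟪(WithLp.toLp 2 ![(215683 / 248965 * (4680 / 14089) : ℝ), 215683 / 248965 * (13289 / 14089), 124356 / 248965] : EuclideanSpace ℝ (Fin 3)), x⟫ = 215683 / 248965 * (4680 / 14089) * x 0 +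
      215683 / 248965 * (13289 / 14089) * x 1 + 124356 / 248965 * x 2 := by
  simp [PiLp.inner_apply, Fin.sum_univ_three]; ring

/-- Membership in the cap cone about `e_z`, in coordinates. -/
theorem mem_capCone_ez {c : ℝ} {x : EuclideanSpace ℝ (Fin 3)} :
    x ∈ capCone (EuclideanSpace.single (2 : Fin 3) (1 : ℝ) : EuclideanSpace ℝ (Fin 3)) c ↔ c * ‖x‖ < x 2 ∧ ‖x‖ < 1 := by
  simp only [capCone, mem_inter_iff, mem_setOf_eq, mem_ball, dist_zero_right, inner_ez]

/-- **The dual-cone test.**  An integer normal `n` with `n_z > 0` and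
`(1250² − 893²)(n_x² + n_y²) ≤ 893² n_z²` pairs nonnegatively with every `x` of the open cone
`(893/1250)‖x‖ < x_z` (Cauchy–Schwarz in the `xy`-plane). [folklore] -/
theorem dualCone_nonneg {n₀ n₁ n₂ : ℤ} (h1 : 0 < n₂)
    (h2 : (1250 ^ 2 - 893 ^ 2) * (n₀ ^ 2 + n₁ ^ 2) ≤ 893 ^ 2 * n₂ ^ 2) {x : EuclideanSpace ℝ (Fin 3)}
    (hx : 893 / 1250 * ‖x‖ < x 2) :
    0 ≤ (n₀ : ℝ) * x 0 + (n₁ : ℝ) * x 1 + (n₂ : ℝ) * x 2 := by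
  have hx2 : 0 < x 2 := lt_of_le_of_lt (by positivity) hx
  have hsq : (893 : ℝ) ^ 2 * (x 0 ^ 2 + x 1 ^ 2) ≤ (1250 ^ 2 - 893 ^ 2) * x 2 ^ 2 := by
    have h3 : ‖x‖ ^ 2 = x 0 ^ 2 + x 1 ^ 2 + x 2 ^ 2 := by
      rw [EuclideanSpace.norm_sq_eq]; simp [Fin.sum_univ_three]
    have h' : (893 / 1250 * ‖x‖) ^ 2 < x 2 ^ 2 := pow_lt_pow_left₀ hx (by positivity) two_ne_zero
    nlinarith
  have h2' : (1250 ^ 2 - 893 ^ 2 : ℝ) * ((n₀ : ℝ) ^ 2 + (n₁ : ℝ) ^ 2) ≤ 893 ^ 2 * (n₂ : ℝ) ^ 2 := by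
    exact_mod_cast h2
  have key := mul_le_mul h2' hsq (by positivity) (by positivity)
  have hAB : ((n₀ : ℝ) ^ 2 + (n₁ : ℝ) ^ 2) * (x 0 ^ 2 + x 1 ^ 2) ≤ (n₂ : ℝ) ^ 2 * x 2 ^ 2 := by
    nlinarith [key]
  have hCS : ((n₀ : ℝ) * x 0 + n₁ * x 1) ^ 2 ≤ ((n₀ : ℝ) ^ 2 + (n₁ : ℝ) ^ 2) * (x 0 ^ 2 + x 1 ^ 2) := by
    nlinarith [sq_nonneg ((n₀ : ℝ) * x 1 - n₁ * x 0)]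
  have hN : 0 < (n₂ : ℝ) * x 2 := mul_pos (by exact_mod_cast h1) hx2
  by_contra hneg
  push Not at hneg
  nlinarith [hCS, hAB, hN, hneg, mul_pos hN (by linarith : 0 < (n₂ : ℝ) * x 2 -
    ((n₀ : ℝ) * x 0 + n₁ * x 1))]

/-- **The OV cone is closed under nonnegative combinations with a positive coefficient**: if
`u₀, u₁, u₂` satisfy `(893/1250)‖u‖ < u_z < ⟪c₁,u⟫, u_z < ⟪c₂,u⟫` then so does
`c₀u₀ + c₁u₁ + c₂u₂` for `cᵢ ≥ 0` not all zero. [folklore] -/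
theorem combo_mem_cone {u₀ u₁ u₂ : EuclideanSpace ℝ (Fin 3)} {c₀ c₁ c₂ : ℝ}
    (h₀ : 893 / 1250 * ‖u₀‖ < u₀ 2 ∧ u₀ 2 < ⟪(WithLp.toLp 2 ![(215683 / 248965 : ℝ), 0, 124356 / 248965] : EuclideanSpace ℝ (Fin 3)), u₀⟫ ∧
      u₀ 2 < ⟪(WithLp.toLp 2 ![(215683 / 248965 * (4680 / 14089) : ℝ), 215683 / 248965 * (13289 / 14089), 124356 / 248965] : EuclideanSpace ℝ (Fin 3)), u₀⟫)
    (h₁ : 893 / 1250 * ‖u₁‖ < u₁ 2 ∧ u₁ 2 < ⟪(WithLp.toLp 2 ![(215683 / 248965 : ℝ), 0, 124356 / 248965] : EuclideanSpace ℝ (Fin 3)), u₁⟫ ∧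
      u₁ 2 < ⟪(WithLp.toLp 2 ![(215683 / 248965 * (4680 / 14089) : ℝ), 215683 / 248965 * (13289 / 14089), 124356 / 248965] : EuclideanSpace ℝ (Fin 3)), u₁⟫)
    (h₂ : 893 / 1250 * ‖u₂‖ < u₂ 2 ∧ u₂ 2 < ⟪(WithLp.toLp 2 ![(215683 / 248965 : ℝ), 0, 124356 / 248965] : EuclideanSpace ℝ (Fin 3)), u₂⟫ ∧
      u₂ 2 < ⟪(WithLp.toLp 2 ![(215683 / 248965 * (4680 / 14089) : ℝ), 215683 / 248965 * (13289 / 14089), 124356 / 248965] : EuclideanSpace ℝ (Fin 3)), u₂⟫)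
    (hc₀ : 0 ≤ c₀) (hc₁ : 0 ≤ c₁) (hc₂ : 0 ≤ c₂) (hpos : 0 < c₀ + c₁ + c₂) :
    893 / 1250 * ‖c₀ • u₀ + c₁ • u₁ + c₂ • u₂‖ < (c₀ • u₀ + c₁ • u₁ + c₂ • u₂) 2 ∧
      (c₀ • u₀ + c₁ • u₁ + c₂ • u₂) 2 < ⟪(WithLp.toLp 2 ![(215683 / 248965 : ℝ), 0, 124356 / 248965] : EuclideanSpace ℝ (Fin 3)), c₀ • u₀ + c₁ • u₁ + c₂ • u₂⟫ ∧
      (c₀ • u₀ + c₁ • u₁ + c₂ • u₂) 2 < ⟪(WithLp.toLp 2 ![(215683 / 248965 * (4680 / 14089) : ℝ), 215683 / 248965 * (13289 / 14089), 124356 / 248965] : EuclideanSpace ℝ (Fin 3)), c₀ • u₀ + c₁ • u₁ + c₂ • u₂⟫ := by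
  have hn : ‖c₀ • u₀ + c₁ • u₁ + c₂ • u₂‖ ≤ c₀ * ‖u₀‖ + c₁ * ‖u₁‖ + c₂ * ‖u₂‖ := by
    calc ‖c₀ • u₀ + c₁ • u₁ + c₂ • u₂‖ ≤ ‖c₀ • u₀‖ + ‖c₁ • u₁‖ + ‖c₂ • u₂‖ :=
          norm_add₃_le
      _ = c₀ * ‖u₀‖ + c₁ * ‖u₁‖ + c₂ * ‖u₂‖ := by
          rw [norm_smul, norm_smul, norm_smul, Real.norm_of_nonneg hc₀, Real.norm_of_nonneg hc₁,
            Real.norm_of_nonneg hc₂]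
  have e2 : (c₀ • u₀ + c₁ • u₁ + c₂ • u₂) 2 = c₀ * u₀ 2 + c₁ * u₁ 2 + c₂ * u₂ 2 := by
    simp [PiLp.add_apply, PiLp.smul_apply]
  rw [e2, inner_add_right, inner_add_right, real_inner_smul_right, real_inner_smul_right,
    real_inner_smul_right, inner_add_right, inner_add_right, real_inner_smul_right,
    real_inner_smul_right, real_inner_smul_right]
  obtain ⟨a0, b0, d0⟩ := h₀
  obtain ⟨a1, b1, d1⟩ := h₁
  obtain ⟨a2, b2, d2⟩ := h₂
  rcases lt_or_eq_of_le hc₀ with p0 | p0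
  · refine ⟨?_, ?_, ?_⟩
    · nlinarith [mul_le_mul_of_nonneg_left a1.le hc₁, mul_le_mul_of_nonneg_left a2.le hc₂,
        mul_lt_mul_of_pos_left a0 p0, norm_nonneg u₀]
    · nlinarith [mul_le_mul_of_nonneg_left b1.le hc₁, mul_le_mul_of_nonneg_left b2.le hc₂,
        mul_lt_mul_of_pos_left b0 p0]
    · nlinarith [mul_le_mul_of_nonneg_left d1.le hc₁, mul_le_mul_of_nonneg_left d2.le hc₂,
        mul_lt_mul_of_pos_left d0 p0]
  rcases lt_or_eq_of_le hc₁ with p1 | p1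
  · refine ⟨?_, ?_, ?_⟩
    · nlinarith [mul_le_mul_of_nonneg_left a0.le hc₀, mul_le_mul_of_nonneg_left a2.le hc₂,
        mul_lt_mul_of_pos_left a1 p1, norm_nonneg u₁]
    · nlinarith [mul_le_mul_of_nonneg_left b0.le hc₀, mul_le_mul_of_nonneg_left b2.le hc₂,
        mul_lt_mul_of_pos_left b1 p1]
    · nlinarith [mul_le_mul_of_nonneg_left d0.le hc₀, mul_le_mul_of_nonneg_left d2.le hc₂,
        mul_lt_mul_of_pos_left d1 p1]
  have p2 : 0 < c₂ := by rw [← p0, ← p1] at hpos; simpa using hpos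
  refine ⟨?_, ?_, ?_⟩
  · nlinarith [mul_le_mul_of_nonneg_left a0.le hc₀, mul_le_mul_of_nonneg_left a1.le hc₁,
      mul_lt_mul_of_pos_left a2 p2, norm_nonneg u₂]
  · nlinarith [mul_le_mul_of_nonneg_left b0.le hc₀, mul_le_mul_of_nonneg_left b1.le hc₁,
      mul_lt_mul_of_pos_left b2 p2]
  · nlinarith [mul_le_mul_of_nonneg_left d0.le hc₀, mul_le_mul_of_nonneg_left d1.le hc₁,
      mul_lt_mul_of_pos_left d2 p2]

end Region

/-- **Registered sub-goal `stub_censusCertTri`** (worker K2a's split of `stub_censusCert`, file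
2/4): Girard–Euler for a positively oriented trihedral cone in determinant form. -/
theorem stub_censusCertTri : ∀ (a b c : EuclideanSpace ℝ (Fin 3)), 0 < Literature.Geometry.DiscreteGeometry.orient3 a b c → Literature.Geometry.DiscreteGeometry.ballFraction (0 : EuclideanSpace ℝ (Fin 3)) ({x : EuclideanSpace ℝ (Fin 3) | 0 ≤ Literature.Geometry.DiscreteGeometry.orient3 b c x} ∩ {x | 0 ≤ Literature.Geometry.DiscreteGeometry.orient3 c a x} ∩ {x | 0 ≤ Literature.Geometry.DiscreteGeometry.orient3 a b x}) = Literature.Geometry.DiscreteGeometry.sphExcess a b c / (4 * Real.pi) :=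
  fun _ _ _ h => ballFraction_tri h

end Summit.AtomisticToContinuum.Crystallization.Theorems.ZeroDefectDensityBirth
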